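import Summits.ResolutionOfSingularities.ResolutionOfSingularities.Theorems.PurelyInseparableDim4E2OfCJSAssemblyPrime
import HarnessLib

/-!
# F4-I(p,p) ⟸ CJS Thm 6.40 ∧ K2(p), every prime `p ≥ 3` — the one-line composition (cell `res-dim4-pi`, p-program)

[OURS · counted 0 · AI work weaker than expert review.]  Cell `res-dim4-pi` (D-0157 DOOR 2), seat `res-dim4-p-11` g2,
filed for the holder's lineage (res-dim4-p-2 g2 CLOSING note 21:50Z, item (1)).  NOTHING here proves `K2(p)`
(`NoAboveFloorTrap p p`, OPEN for `p ≥ 5`), the Cossart–Jannsen–Saito theorem, or resolution of singularities in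
dimension ≥ 4 / characteristic `p`.

`E2OfCJS.noWideTrap_of_KeyTheorem640` (res-dim4-p-2 g2, p671312: the wide third of F4-I(p,p) from the named fact F-111,
every p-row of the transfer row a tree theorem) composed with res-dim4-p-12 g2's residual trichotomy
`RidgeBudget.noIsolatedTrap_of_residual` (p661515: `NoWideTrap ∧ NoAboveFloorTrap ⇒ NoIsolatedTrap`):

* **`noIsolatedTrap_of_KeyTheorem640_of_K2 (p) [Fact p.Prime] (hp3 : 3 ≤ p) (hK640) (hK2 : NoAboveFloorTrap p p) :
  NoIsolatedTrap p p`** — F4-I(p,p) ⟸ F-111 ∧ K2(p);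
* the `p = 3` instance (K2(3) = `RidgeBudget.noAboveFloorTrap_three`) is ALREADY the tree's
  `noIsolatedTrap_three_three_of_KeyTheorem640'` (p669181) — not restated here (dedup).

bears_on: LADDER-RESOLUTION:D157-DOOR2 (res-dim4-pi · F4-I(p,p) · p-program assembly).  Supports
stmt-ResolutionOfSingularities-16155 (helper).
-/

set_option linter.dupNamespace false -- mandated namespace of this single-conjunct summit

noncomputable section

open Literature.AlgebraicGeometry.CossartJannsenSaito2020

namespace Summit.ResolutionOfSingularities.ResolutionOfSingularities.Theorems.PIDim4

namespace E2OfCJS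

/-- **F4-I(p,p) ⟸ CJS Thm 6.40 ∧ K2(p)** for every prime `p ≥ 3`: no infinite branch of point blow-ups through ISOLATED
`p`-fold points of `z^p + F(x₁,…,x₄)` in characteristic `p`, GIVEN the named fact `KeyTheorem640_char_localized_isolated`
(F-111) and the open letter `NoAboveFloorTrap p p` = K2(p). [OURS · conditional assembly · counted 0]
[cite: CossartJannsenSaito2020, Thm. 6.40] -/
theorem noIsolatedTrap_of_KeyTheorem640_of_K2 (p : ℕ) [Fact p.Prime] (hp3 : 3 ≤ p)
    (hK640 : KeyTheorem640_char_localized_isolated.{0}) (hK2 : RidgeBudget.NoAboveFloorTrap p p) :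
    NoIsolatedTrap p p :=
  RidgeBudget.noIsolatedTrap_of_residual p (noWideTrap_of_KeyTheorem640 p hp3 hK640) hK2

end E2OfCJS

end Summit.ResolutionOfSingularities.ResolutionOfSingularities.Theorems.PIDim4

end
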